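import Summits.KontsevichZagierPeriods.KontsevichZagierPeriods.Theorems.RootDecompRelativeModAbsoluteCylLogSplitP37

/-! # `RootDecompRelativeModAbsoluteCylLogSplitP38` — part 13/27 of the mechanical ≤400-line split of `RungClosure.lean` (sha256 f909f334226f0fb5…)
Source: decomp-kz lens-3 g12 `RungClosure.lean` v9 (HOME/decomp-kz-lens-3/g12/, sha256 f909f334…; critic g4-52/g4-57/g5 CLEARED, «lander: split v9 --supports 30572»): BLOCK I (57 g11 monolith decls missing from P01–P25), BLOCK II/III (WildCertAssembly parts 1–6, 8–10: `Leaf.cellLocalWildCert`, `Leaf.cylKernelZeroLog_of_trees`), Parts 12–13 (`Leaf.regKernelPairDegOne_iff_circlePos_of_trees`), BLOCK G13 (Möbius engine, test §C decided).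
Split by census-1 g9 `gen/splitlean.py`: scopes re-opened with their `open`/`variable`/`set_option` context; mathematics and declaration order unchanged. -/

noncomputable section
open Set MeasureTheory Filter Topology
open scoped BigOperators
open Literature.NumberTheory.Transcendental Literature.ModelTheory.ExponentialFields
namespace Summit.KontsevichZagierPeriods.RootDecompRelativeModAbsolute.Rung30571.RegularisedLogLayer.CylLogLeaf

/-! ## Part B — `LineStructure` -/
/-- **One rational point per component.**  For an open `ℚ`-semialgebraic `E ⊆ ℝ¹`: finitely many rationals in `E`, pairwise separated by
points outside `E`, such that every point of `E` sees one of them along a closed segment inside `E`. -/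
theorem exists_rational_cuts {E : Set (Fin 1 → ℝ)} (hEo : IsOpen E)
    (hfr : (frontier ((fun r : ℝ => fun _ : Fin 1 => r) ⁻¹' E)).Finite) :
    ∃ (n : ℕ) (r : Fin n → ℚ),
      (∀ j, (fun _ : Fin 1 => (r j : ℝ)) ∈ E) ∧
      (∀ j j', j ≠ j' → ∃ f : ℝ, (fun _ : Fin 1 => f) ∉ E ∧
          (((r j : ℝ) < f ∧ f < (r j' : ℝ)) ∨ ((r j' : ℝ) < f ∧ f < (r j : ℝ)))) ∧
      ∀ w ∈ E, ∃ j, ∀ y ∈ Set.uIcc (w 0) (r j : ℝ), (fun _ : Fin 1 => y) ∈ E := by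
  classical
  set E₀ : Set ℝ := (fun r : ℝ => fun _ : Fin 1 => r) ⁻¹' E with hE₀
  have hmemE₀ : ∀ y : ℝ, y ∈ E₀ ↔ (fun _ : Fin 1 => y) ∈ E := fun y => Iff.rfl
  have hE₀o : IsOpen E₀ := hEo.preimage (continuous_pi fun _ => continuous_id)
  have hGfin : (frontier E₀).Finite := hfr
  set G : Finset ℝ := hGfin.toFinset with hGdef
  have hGmem : ∀ g, g ∈ G ↔ g ∈ frontier E₀ := fun g => Set.Finite.mem_toFinset _
  have hGE : ∀ g ∈ G, g ∉ E₀ := by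
    intro g hg hgE
    have h0 := hE₀o.inter_frontier_eq
    have : g ∈ E₀ ∩ frontier E₀ := ⟨hgE, (hGmem g).1 hg⟩
    rw [h0] at this
    exact this
  -- the classes
  let J : Finset ℝ → Set ℝ := fun S => {y | y ∉ G ∧ ∀ g ∈ G, g ∈ S ↔ g < y}
  have hJself : ∀ x, x ∉ G → x ∈ J (G.filter (· < x)) := by
    intro x hx
    refine ⟨hx, fun g hg => ?_⟩
    simp [Finset.mem_filter, hg]
  have hJord : ∀ S, (J S).OrdConnected := by
    intro S
    refine ⟨fun y₁ hy₁ y₂ hy₂ y hy => ?_⟩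
    refine ⟨fun hyG => ?_, fun g hg => ?_⟩
    · rcases eq_or_lt_of_le hy.2 with h | h
      · exact hy₂.1 (h ▸ hyG)
      · have hS : y ∈ S := ((hy₂.2 y hyG).2 h)
        have : y < y₁ := (hy₁.2 y hyG).1 hS
        exact absurd hy.1 (not_le.2 this)
    · constructor
      · intro hgS
        exact lt_of_lt_of_le ((hy₁.2 g hg).1 hgS) hy.1
      · intro hgy
        exact (hy₂.2 g hg).2 (lt_of_lt_of_le hgy hy.2)
  have hJsub : ∀ S x, x ∈ E₀ → x ∈ J S → J S ⊆ E₀ := by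
    intro S x hxE hxJ
    refine (hJord S).isPreconnected.subset_left_of_subset_union (v := (closure E₀)ᶜ) hE₀o
      (isClosed_closure (s := E₀)).isOpen_compl ?_ ?_ ⟨x, hxJ, hxE⟩
    · exact Set.disjoint_left.2 fun y hy hyc => hyc (subset_closure hy)
    · intro y hy
      by_cases hcl : y ∈ closure E₀
      · left
        have hyfr : y ∉ frontier E₀ := fun h => hy.1 ((hGmem y).2 h)
        have hint : y ∈ interior E₀ := by
          by_contra hni
          exact hyfr ⟨hcl, hni⟩
        exact interior_subset hint
      · right
        exact hcl
  -- a rational representative in each class meeting `E₀`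
  have hrep : ∀ S x, x ∈ E₀ → x ∈ J S → ∃ q : ℚ, (q : ℝ) ∈ E₀ ∧ (q : ℝ) ∈ J S := by
    intro S x hxE hxJ
    obtain ⟨ε, hε, hball⟩ := Metric.isOpen_iff.1 hE₀o x hxE
    obtain ⟨q, hxq, hqε⟩ := exists_rat_btwn (show x < x + ε by linarith)
    have hqE : (q : ℝ) ∈ E₀ := hball (by rw [Metric.mem_ball, Real.dist_eq, abs_lt]; constructor <;> linarith)
    refine ⟨q, hqE, fun hqG => hGE _ hqG hqE, fun g hg => ?_⟩
    rw [hxJ.2 g hg]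
    constructor
    · intro h; exact h.trans hxq
    · intro hgq
      by_contra hgx
      have hgx' : x ≤ g := not_lt.1 hgx
      have hgE : g ∈ E₀ := hball (by rw [Metric.mem_ball, Real.dist_eq, abs_lt]; constructor <;> linarith)
      exact hGE g hg hgE
  -- index set: classes (coded by `S ⊆ G`) meeting `E₀`
  let T : Finset (Finset ℝ) := G.powerset.filter (fun S => ∃ x ∈ E₀, x ∈ J S)
  have hT : ∀ S : T, ∃ q : ℚ, (q : ℝ) ∈ E₀ ∧ (q : ℝ) ∈ J S.1 := by
    intro S
    have hS := (Finset.mem_filter.1 S.2).2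
    obtain ⟨x, hxE, hxJ⟩ := hS
    exact hrep S.1 x hxE hxJ
  choose rq hrqE hrqJ using hT
  let e := T.equivFin
  refine ⟨T.card, fun j => rq (e.symm j), fun j => (hmemE₀ _).1 (hrqE _), ?_, ?_⟩
  · -- separation of two distinct classes
    intro j j' hjj
    have hSS : (e.symm j).1 ≠ (e.symm j').1 := by
      intro h
      exact hjj (e.symm.injective (Subtype.ext h))
    obtain ⟨g, hg⟩ : ∃ g, ¬ (g ∈ (e.symm j).1 ↔ g ∈ (e.symm j').1) :=
      not_forall.1 fun hall => hSS (Finset.ext hall)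
    have hSG : (e.symm j).1 ⊆ G := Finset.mem_powerset.1 (Finset.mem_filter.1 (e.symm j).2).1
    have hSG' : (e.symm j').1 ⊆ G := Finset.mem_powerset.1 (Finset.mem_filter.1 (e.symm j').2).1
    have hq := hrqJ (e.symm j)
    have hq' := hrqJ (e.symm j')
    by_cases h1 : g ∈ (e.symm j).1
    · have h2 : g ∉ (e.symm j').1 := fun h2 => hg ⟨fun _ => h2, fun _ => h1⟩
      have hgG : g ∈ G := hSG h1
      have hlt : g < rq (e.symm j) := (hq.2 g hgG).1 h1
      have hnlt : ¬ g < rq (e.symm j') := fun h => h2 ((hq'.2 g hgG).2 h)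
      have hne : (rq (e.symm j') : ℝ) ≠ g := fun h => hGE g hgG (h ▸ hrqE (e.symm j'))
      refine ⟨g, fun h => hGE g hgG ((hmemE₀ g).2 h), Or.inr ⟨lt_of_le_of_ne (not_lt.1 hnlt) hne, hlt⟩⟩
    · have h2 : g ∈ (e.symm j').1 := by
        by_contra h2; exact hg ⟨fun h => absurd h h1, fun h => absurd h h2⟩
      have hgG : g ∈ G := hSG' h2
      have hlt : g < rq (e.symm j') := (hq'.2 g hgG).1 h2
      have hnlt : ¬ g < rq (e.symm j) := fun h => h1 ((hq.2 g hgG).2 h)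
      have hne : (rq (e.symm j) : ℝ) ≠ g := fun h => hGE g hgG (h ▸ hrqE (e.symm j))
      refine ⟨g, fun h => hGE g hgG ((hmemE₀ g).2 h), Or.inl ⟨lt_of_le_of_ne (not_lt.1 hnlt) hne, hlt⟩⟩
  · -- covering
    intro w hw
    have hx0 : (fun _ : Fin 1 => w 0) = w := by
      funext i; rw [Subsingleton.elim i 0]
    have hxE : w 0 ∈ E₀ := by rw [hmemE₀, hx0]; exact hw
    have hxG : w 0 ∉ G := fun h => hGE _ h hxE
    let S : Finset ℝ := G.filter (· < w 0)
    have hST : S ∈ T := by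
      refine Finset.mem_filter.2 ⟨Finset.mem_powerset.2 (Finset.filter_subset _ _), w 0, hxE, hJself _ hxG⟩
    refine ⟨e ⟨S, hST⟩, fun y hy => ?_⟩
    have hsymm : e.symm (e ⟨S, hST⟩) = ⟨S, hST⟩ := e.symm_apply_apply _
    have hqJ : (rq (e.symm (e ⟨S, hST⟩)) : ℝ) ∈ J S := by
      rw [hsymm]; exact hrqJ ⟨S, hST⟩
    have hsub : J S ⊆ E₀ := hJsub S (w 0) hxE (hJself _ hxG)
    exact (hmemE₀ y).1 (hsub ((hJord S).uIcc_subset (hJself _ hxG) hqJ hy))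

/-! ## Part C — `LineFrontier` -/
/-- A rational polynomial in the single variable `0 : Fin 1`, evaluated at `r ↦ (r)`, is a one-variable real polynomial function. -/
theorem exists_polynomial_aeval_eq (p : MvPolynomial (Fin 1) ℚ) :
    ∃ q : Polynomial ℝ, ∀ r : ℝ, MvPolynomial.aeval (fun _ : Fin 1 => r) p = q.eval r := by
  refine ⟨MvPolynomial.aeval (fun _ : Fin 1 => (Polynomial.X : Polynomial ℝ)) p, fun r => ?_⟩
  have h := MvPolynomial.comp_aeval_apply (fun _ : Fin 1 => (Polynomial.X : Polynomial ℝ))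
    ((Polynomial.aeval r).restrictScalars ℚ) p
  simp only [AlgHom.restrictScalars_apply, Polynomial.aeval_X] at h
  rw [← Polynomial.coe_aeval_eq_eval]
  exact h.symm

/-- **Local constancy off a finite set** (van den Dries Ch. 1 (3.2) for `ℚ`-semialgebraic subsets of the line). -/
theorem exists_finite_locallyConst {E : Set (Fin 1 → ℝ)} (hE : IsSemialgebraic ℚ E) :
    ∃ F : Set ℝ, F.Finite ∧ ∀ x ∉ F, ∃ a b : ℝ, a < x ∧ x < b ∧
      (Ioo a b ⊆ (fun r : ℝ => fun _ : Fin 1 => r) ⁻¹' E ∨ Ioo a b ⊆ ((fun r : ℝ => fun _ : Fin 1 => r) ⁻¹' E)ᶜ) := by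
  induction hE using BooleanSubalgebra.closure_bot_sup_induction with
  | mem t ht =>
    rcases ht with ⟨p, rfl⟩ | ⟨p, rfl⟩
    · obtain ⟨q, hq⟩ := exists_polynomial_aeval_eq p
      by_cases hq0 : q = 0
      · refine ⟨∅, finite_empty, fun x _ => ⟨x - 1, x + 1, by linarith, by linarith, Or.inl fun y _ => ?_⟩⟩
        show MvPolynomial.aeval (fun _ : Fin 1 => y) p = 0
        rw [hq, hq0, Polynomial.eval_zero]
      · refine ⟨{x | q.IsRoot x}, Polynomial.finite_setOf_isRoot hq0, fun x hx => ?_⟩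
        have hx' : q.eval x ≠ 0 := hx
        obtain ⟨ε, hε, hball⟩ := Metric.isOpen_iff.1 (isOpen_ne_fun q.continuous continuous_const) x hx'
        refine ⟨x - ε, x + ε, by linarith, by linarith, Or.inr fun y hy hyE => ?_⟩
        have hyq : q.eval y ≠ 0 :=
          hball (by rw [Metric.mem_ball, Real.dist_eq, abs_lt]; constructor <;> linarith [hy.1, hy.2])
        apply hyq
        have : MvPolynomial.aeval (fun _ : Fin 1 => y) p = 0 := hyE
        rwa [hq] at this
    · obtain ⟨q, hq⟩ := exists_polynomial_aeval_eq p
      by_cases hq0 : q = 0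
      · refine ⟨∅, finite_empty, fun x _ => ⟨x - 1, x + 1, by linarith, by linarith, Or.inr fun y _ hyE => ?_⟩⟩
        have : 0 < MvPolynomial.aeval (fun _ : Fin 1 => y) p := hyE
        rw [hq, hq0, Polynomial.eval_zero] at this
        exact lt_irrefl _ this
      · refine ⟨{x | q.IsRoot x}, Polynomial.finite_setOf_isRoot hq0, fun x hx => ?_⟩
        have hx' : q.eval x ≠ 0 := hx
        rcases lt_or_gt_of_ne hx' with hneg | hpos
        · obtain ⟨ε, hε, hball⟩ := Metric.isOpen_iff.1 (isOpen_lt q.continuous continuous_const) x hneg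
          refine ⟨x - ε, x + ε, by linarith, by linarith, Or.inr fun y hy hyE => ?_⟩
          have hyq : q.eval y < 0 :=
            hball (by rw [Metric.mem_ball, Real.dist_eq, abs_lt]; constructor <;> linarith [hy.1, hy.2])
          have : 0 < MvPolynomial.aeval (fun _ : Fin 1 => y) p := hyE
          rw [hq] at this
          exact lt_irrefl _ (hyq.trans this)
        · obtain ⟨ε, hε, hball⟩ := Metric.isOpen_iff.1 (isOpen_lt continuous_const q.continuous) x hpos
          refine ⟨x - ε, x + ε, by linarith, by linarith, Or.inl fun y hy => ?_⟩
          have hyq : 0 < q.eval y :=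
            hball (by rw [Metric.mem_ball, Real.dist_eq, abs_lt]; constructor <;> linarith [hy.1, hy.2])
          show 0 < MvPolynomial.aeval (fun _ : Fin 1 => y) p
          rw [hq]
          exact hyq
  | bot =>
    exact ⟨∅, finite_empty, fun x _ => ⟨x - 1, x + 1, by linarith, by linarith, Or.inr fun y _ h => h⟩⟩
  | sup s _ t _ ihs iht =>
    obtain ⟨F, hF, hs⟩ := ihs
    obtain ⟨G, hG, ht⟩ := iht
    refine ⟨F ∪ G, hF.union hG, fun x hx => ?_⟩
    rw [mem_union, not_or] at hx
    obtain ⟨a, b, ha, hb, h1⟩ := hs x hx.1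
    obtain ⟨a', b', ha', hb', h2⟩ := ht x hx.2
    refine ⟨max a a', min b b', max_lt ha ha', lt_min hb hb', ?_⟩
    have sub1 : Ioo (max a a') (min b b') ⊆ Ioo a b :=
      Ioo_subset_Ioo (le_max_left _ _) (min_le_left _ _)
    have sub2 : Ioo (max a a') (min b b') ⊆ Ioo a' b' :=
      Ioo_subset_Ioo (le_max_right _ _) (min_le_right _ _)
    rcases h1 with h1 | h1
    · exact Or.inl fun y hy => Or.inl (h1 (sub1 hy))
    · rcases h2 with h2 | h2
      · exact Or.inl fun y hy => Or.inr (h2 (sub2 hy))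
      · refine Or.inr fun y hy hy' => ?_
        rcases hy' with hy' | hy'
        · exact h1 (sub1 hy) hy'
        · exact h2 (sub2 hy) hy'
  | compl s _ ih =>
    obtain ⟨F, hF, hs⟩ := ih
    refine ⟨F, hF, fun x hx => ?_⟩
    obtain ⟨a, b, ha, hb, h⟩ := hs x hx
    refine ⟨a, b, ha, hb, ?_⟩
    rcases h with h | h
    · exact Or.inr fun y hy hy' => hy' (h hy)
    · exact Or.inl fun y hy => h hy

/-- **The frontier of (the pull-back to `ℝ` of) a `ℚ`-semialgebraic subset of the line is finite.** -/
theorem finite_frontier_of_isSemialgebraic {E : Set (Fin 1 → ℝ)} (hE : IsSemialgebraic ℚ E) :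
    (frontier ((fun r : ℝ => fun _ : Fin 1 => r) ⁻¹' E)).Finite := by
  set E₀ : Set ℝ := (fun r : ℝ => fun _ : Fin 1 => r) ⁻¹' E with hE₀
  obtain ⟨F, hFfin, hF⟩ := exists_finite_locallyConst hE
  refine hFfin.subset fun x hx => ?_
  by_contra hxF
  obtain ⟨a, b, hax, hxb, hab⟩ := hF x hxF
  have hx' : x ∈ closure E₀ \ interior E₀ := hx
  rcases hab with h | h
  · exact hx'.2 (mem_interior.2 ⟨Ioo a b, h, isOpen_Ioo, ⟨hax, hxb⟩⟩)
  · obtain ⟨y, hy1, hy2⟩ := mem_closure_iff_nhds.1 hx'.1 (Ioo a b) (Ioo_mem_nhds hax hxb)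
    exact h hy1 hy2

/-! ## Assembly of Step 1 -/

/-- The `2n` one-ended pieces attached to the rational points `r : Fin n → ℚ`. -/
def step1Piece (E : Set (Fin 1 → ℝ)) {n : ℕ} (r : Fin n → ℚ) : Fin n × Bool → Set (Fin 1 → ℝ)
  | (j, false) => segBelow E (r j)
  | (j, true) => segAbove E (r j)

/-- **Step 1 of T4.**  For an open `ℚ`-semialgebraic `E ⊆ ℝ¹` with finite frontier, the one-ended pieces `step1Piece E r` at suitable rational
points `r j ∈ E` are open, `ℚ`-semialgebraic, contained in `E`, pairwise disjoint, and cover `E` up to a (finite, hence) null set. -/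
theorem exists_oneEnded_pieces {E : Set (Fin 1 → ℝ)} (hEo : IsOpen E) (hE : IsSemialgebraic ℚ E)
    (hfr : (frontier ((fun r : ℝ => fun _ : Fin 1 => r) ⁻¹' E)).Finite) :
    ∃ (n : ℕ) (r : Fin n → ℚ), (∀ j, (fun _ : Fin 1 => (r j : ℝ)) ∈ E) ∧
      (∀ p, IsOpen (step1Piece E r p)) ∧ (∀ p, IsSemialgebraic ℚ (step1Piece E r p)) ∧
      (∀ p, step1Piece E r p ⊆ E) ∧ Pairwise (Function.onFun Disjoint (step1Piece E r)) ∧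
      volume (E \ ⋃ p, step1Piece E r p) = 0 := by
  obtain ⟨n, r, hrE, hsep, hcov⟩ := exists_rational_cuts hEo hfr
  refine ⟨n, r, hrE, ?_, ?_, ?_, ?_, ?_⟩
  · rintro ⟨j, b⟩; cases b
    · exact isOpen_segBelow hEo (r j)
    · exact isOpen_segAbove hEo (r j)
  · rintro ⟨j, b⟩; cases b
    · exact isSemialgebraic_segBelow hE (r j)
    · exact isSemialgebraic_segAbove hE (r j)
  · rintro ⟨j, b⟩; cases b
    · exact segBelow_subset E (r j)
    · exact segAbove_subset E (r j)
  · rintro ⟨j, b⟩ ⟨j', b'⟩ hne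
    by_cases hjj : j = j'
    · subst hjj
      cases b <;> cases b'
      · exact absurd rfl hne
      · exact disjoint_segBelow_segAbove E (r j)
      · exact (disjoint_segBelow_segAbove E (r j)).symm
      · exact absurd rfl hne
    · obtain ⟨f, hfE, hf⟩ := hsep j j' hjj
      rcases hf with ⟨h1, h2⟩ | ⟨h1, h2⟩
      · obtain ⟨dAB, dAA, dBB, dBA⟩ := disjoint_seg_of_separated h1 h2 hfE
        cases b <;> cases b'
        · exact dBB
        · exact dBA
        · exact dAB
        · exact dAA
      · obtain ⟨dAB, dAA, dBB, dBA⟩ := disjoint_seg_of_separated h1 h2 hfE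
        cases b <;> cases b'
        · exact dBB.symm
        · exact dAB.symm
        · exact dBA.symm
        · exact dAA.symm
  · refine measure_mono_null (fun w hw => ?_)
      ((Set.finite_range (fun j : Fin n => fun _ : Fin 1 => (r j : ℝ))).measure_zero volume)
    obtain ⟨hwE, hwU⟩ := hw
    obtain ⟨j, hj⟩ := hcov w hwE
    rcases lt_trichotomy (w 0) (r j : ℝ) with hlt | heq | hgt
    · refine absurd (Set.mem_iUnion.2 ⟨(j, false), ?_⟩) hwU
      exact ⟨hlt, fun y hy hy' => hj y (Set.mem_uIcc.2 (Or.inl ⟨hy, hy'.le⟩))⟩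
    · refine ⟨j, ?_⟩
      funext i
      rw [Subsingleton.elim i 0]
      exact heq.symm
    · refine absurd (Set.mem_iUnion.2 ⟨(j, true), ?_⟩) hwU
      exact ⟨hgt, fun y hy hy' => hj y (Set.mem_uIcc.2 (Or.inr ⟨hy.le, hy'⟩))⟩

/-- **Step 1 of T4, unconditional.**  For every open `ℚ`-semialgebraic `E ⊆ ℝ¹`: rational points `r j ∈ E` whose one-ended pieces
`step1Piece E r` are open, `ℚ`-semialgebraic, inside `E`, pairwise disjoint, and cover `E` up to a null set — the hypotheses `hCE/hdisj/hnull`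
of §3al `localWildCert_of_pieces`. -/
theorem exists_oneEnded_pieces_of_isSemialgebraic {E : Set (Fin 1 → ℝ)} (hEo : IsOpen E) (hE : IsSemialgebraic ℚ E) :
    ∃ (n : ℕ) (r : Fin n → ℚ), (∀ j, (fun _ : Fin 1 => (r j : ℝ)) ∈ E) ∧
      (∀ p, IsOpen (step1Piece E r p)) ∧ (∀ p, IsSemialgebraic ℚ (step1Piece E r p)) ∧
      (∀ p, step1Piece E r p ⊆ E) ∧ Pairwise (Function.onFun Disjoint (step1Piece E r)) ∧
      volume (E \ ⋃ p, step1Piece E r p) = 0 :=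
  exists_oneEnded_pieces hEo hE (finite_frontier_of_isSemialgebraic hE)

/-! ## Part D — geometry of the one-ended pieces (item G1): `segBelow E r = (e, r)` with `(e) ∉ E`, or `= (−∞, r)`; mirror for `segAbove` -/

end Summit.KontsevichZagierPeriods.RootDecompRelativeModAbsolute.Rung30571.RegularisedLogLayer.CylLogLeaf
end
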